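import Summits.AtomisticToContinuum.FouriersLaw.Theorems.HonestZwanzigFeshbachIdentitiesResolventB
import Summits.AtomisticToContinuum.FouriersLaw.Theorems.HonestZwanzigFeshbachIdentitiesCorrelations
import Summits.AtomisticToContinuum.FouriersLaw.Theorems.HonestZwanzigFeshbachIdentitiesCovariance

/-!
# `HonestZwanzig.FeshbachIdentities`, part 7: positivity of the Laplace-transformed autocorrelation and of `G(s)`

Support file for item `stmt-AtomisticToContinuum-12697` (`HonestZwanzig.FeshbachIdentities`), clause (iv-b).
With the route's gadgets `corr(f,g)(t) = ⟨f, P_t g⟩_{μ_T} - μ_T(f)μ_T(g)` and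
`lap_s(f,g) = ∫_{(0,∞)} e^{-st} corr(f,g)(t) dt` (pinned anharmonic chain, equal bath temperatures `T > 0`, nice
observables, `s > 0`):

* `pinnedChain_integral_resolvent_eq` — `∫ R_s g dμ_T = μ_T(g)/s` (invariance);
* `pinnedChain_lap_eq_integral_mul_resolvent` — `lap_s(f,g) = ⟨f, R_s g⟩_{μ_T} - μ_T(f)μ_T(g)/s` (Fubini);
* `pinnedChain_lap_self_eq_centred` — `lap_s(u,u) = ⟨ũ, R_s ũ⟩_{μ_T}`, `ũ = u - μ_T(u)`;
* `pinnedChain_lap_self_pos` — **`lap_s(u,u) > 0`** whenever `Var_{μ_T}(u) > 0` (the resolvent inequality and the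
  injectivity of `R_s`, part 6);
* `pinnedChain_corr_sum_sum`, `pinnedChain_sum_lap_eq_lap_sum`, `pinnedChain_sum_lap_pos` — the matrix form of the
  route: `ξᵀ G(s) ξ = lap_s(u,u) > 0` for `G(s)_{xy} = lap_s(e_x,e_y)`, `u = ∑ ξ_x e_x` non-constant (bilinearity, and
  the positivity of the variance of a non-constant continuous observable, part 2).
-/

noncomputable section

open MeasureTheory ProbabilityTheory Filter Topology Set Function
open scoped NNReal ENNReal
open Literature.MathematicalPhysics.KineticTheory.HeatConduction
open Literature.MathematicalPhysics.KineticTheory Literature.Probability.Process OscillatorChain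
open Summit.AtomisticToContinuum.FouriersLaw.Theorems.SubdiffusiveBondHeat
open Summit.AtomisticToContinuum.FouriersLaw.Theorems.OddSectorIrreversibility
open Summit.AtomisticToContinuum.FouriersLaw.Theorems.ExtensiveSnapshotIrreversibility.ClausiusBudget

namespace Summit.AtomisticToContinuum.FouriersLaw.Theorems.HonestZwanzig

variable {N : ℕ}

section PinnedL

variable {ω₂ lam β γ : ℝ} (hω : 0 < ω₂) (hl : 0 ≤ lam) (hβ : 0 < β) (hγ : 0 < γ) (hN : 0 < N)
  {T : ℝ} (hT : 0 < T)
include hω hl hβ hγ hN hT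

/-! ### The Laplace-transformed correlation as a resolvent pairing -/

/-- **`∫ R_s g dμ_T = μ_T(g)/s`** for a nice `g` and `s > 0` (Fubini and invariance of `μ_T`). [folklore] -/
theorem pinnedChain_integral_resolvent_eq {ϑ : ℝ} (hϑ0 : 0 < ϑ) (h2ϑ : 2 * ϑ < 1 / T)
    {g : PhaseSpace N → ℝ} (hg : Continuous g) {Cg : ℝ} (hCg : 0 ≤ Cg)
    (hgb : ∀ y, |g y| ≤ Cg * Real.exp (ϑ * (pinnedChain ω₂ lam β γ).hamiltonian N y)) {s : ℝ} (hs : 0 < s) :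
    ∫ z, (∫ t in Ioi (0 : ℝ), Real.exp (-(s * t)) *
        ∫ y, g y ∂((pinnedChain ω₂ lam β γ).transitionKernel N T T t.toNNReal z)) ∂((pinnedChain ω₂ lam β γ).gibbsMeasure N T) =
      (∫ z, g z ∂((pinnedChain ω₂ lam β γ).gibbsMeasure N T)) / s := by
  have hϑ1 : ϑ < 1 / T := by linarith
  set P := pinnedChain ω₂ lam β γ with hP
  set μ := P.gibbsMeasure N T with hμ
  haveI : IsProbabilityMeasure μ := pinnedChain_isProbabilityMeasure_gibbsMeasure hω hl hβ.le γ N hT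
  obtain ⟨K, c, -, hc, hb⟩ := pinnedChain_harris_bound hω hl hβ hγ hN hT hϑ0 hϑ1
  have hE2 : Integrable (fun y => Real.exp (2 * ϑ * P.hamiltonian N y)) μ :=
    pinnedChain_integrable_exp_mul_hamiltonian_gibbsMeasure hω hl hβ.le γ N hT h2ϑ
  have hexp : IntegrableOn (fun t : ℝ => Real.exp (-(s * t))) (Ioi 0) := by
    have := exp_neg_integrableOn_Ioi 0 hs
    refine this.congr (Eventually.of_forall fun t => ?_); simp [neg_mul]
  have hone2 : Integrable (fun _ : PhaseSpace N => (1 : ℝ) ^ 2) μ := integrable_const _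
  have h1 := pinnedChain_integral_mul_setIntegral_exp_act hω hl hβ hγ hϑ0 hb hc hg hCg hgb μ hE2
    (F := fun _ => (1 : ℝ)) stronglyMeasurable_const hone2 hexp
  have h1' : ∫ z, (∫ t in Ioi (0 : ℝ), Real.exp (-(s * t)) *
      ∫ y, g y ∂(P.transitionKernel N T T t.toNNReal z)) ∂μ =
      ∫ t in Ioi (0 : ℝ), Real.exp (-(s * t)) * ∫ z, (∫ y, g y ∂(P.transitionKernel N T T t.toNNReal z)) ∂μ := by
    simpa only [one_mul] using h1
  rw [h1']
  have hgi : Integrable g μ := pinnedChain_integrable_nice hω hl hβ hT hϑ1 hg hgb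
  have h2 : ∀ t : ℝ, ∫ z, (∫ y, g y ∂(P.transitionKernel N T T t.toNNReal z)) ∂μ = ∫ z, g z ∂μ := fun t =>
    pinnedChain_integral_transitionKernel_gibbsMeasure hω hl hβ.le hγ.le hN hT _ hgi
  simp only [h2]
  rw [integral_mul_const, integral_exp_neg_mul_Ioi hs]
  ring

/-- **`lap_s(f, g) = ⟨f, R_s g⟩_{μ_T} - μ_T(f)μ_T(g)/s`**: for nice `f, g` and `s > 0`,
`∫_{(0,∞)} e^{-st} (⟨f, P_t g⟩ - μ_T(f)μ_T(g)) dt = ∫ f · R_s g dμ_T - μ_T(f)μ_T(g)/s` (Fubini). [folklore] -/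
theorem pinnedChain_lap_eq_integral_mul_resolvent {ϑ : ℝ} (hϑ0 : 0 < ϑ) (h2ϑ : 2 * ϑ < 1 / T)
    {f g : PhaseSpace N → ℝ} (hf : Continuous f) (hg : Continuous g) {Cf Cg : ℝ} (hCf : 0 ≤ Cf) (hCg : 0 ≤ Cg)
    (hfb : ∀ y, |f y| ≤ Cf * Real.exp (ϑ * (pinnedChain ω₂ lam β γ).hamiltonian N y))
    (hgb : ∀ y, |g y| ≤ Cg * Real.exp (ϑ * (pinnedChain ω₂ lam β γ).hamiltonian N y)) {s : ℝ} (hs : 0 < s) :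
    ∫ t in Ioi (0 : ℝ), Real.exp (-(s * t)) *
        ((∫ z, f z * (∫ y, g y ∂((pinnedChain ω₂ lam β γ).transitionKernel N T T t.toNNReal z))
            ∂((pinnedChain ω₂ lam β γ).gibbsMeasure N T)) -
          (∫ z, f z ∂((pinnedChain ω₂ lam β γ).gibbsMeasure N T)) *
            (∫ z, g z ∂((pinnedChain ω₂ lam β γ).gibbsMeasure N T))) =
      (∫ z, f z * (∫ t in Ioi (0 : ℝ), Real.exp (-(s * t)) *
        ∫ y, g y ∂((pinnedChain ω₂ lam β γ).transitionKernel N T T t.toNNReal z)) ∂((pinnedChain ω₂ lam β γ).gibbsMeasure N T)) -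
      (∫ z, f z ∂((pinnedChain ω₂ lam β γ).gibbsMeasure N T)) *
        (∫ z, g z ∂((pinnedChain ω₂ lam β γ).gibbsMeasure N T)) / s := by
  have hϑ1 : ϑ < 1 / T := by linarith
  set P := pinnedChain ω₂ lam β γ with hP
  set μ := P.gibbsMeasure N T with hμ
  haveI : IsProbabilityMeasure μ := pinnedChain_isProbabilityMeasure_gibbsMeasure hω hl hβ.le γ N hT
  obtain ⟨K, c, -, hc, hb⟩ := pinnedChain_harris_bound hω hl hβ hγ hN hT hϑ0 hϑ1
  have hE2 : Integrable (fun y => Real.exp (2 * ϑ * P.hamiltonian N y)) μ :=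
    pinnedChain_integrable_exp_mul_hamiltonian_gibbsMeasure hω hl hβ.le γ N hT h2ϑ
  have hexp : IntegrableOn (fun t : ℝ => Real.exp (-(s * t))) (Ioi 0) := by
    have := exp_neg_integrableOn_Ioi 0 hs
    refine this.congr (Eventually.of_forall fun t => ?_); simp [neg_mul]
  have hf2 : Integrable (fun z => f z ^ 2) μ := pinnedChain_integrable_sq_nice hω hl hβ hT h2ϑ hf hfb
  have hF := pinnedChain_integral_mul_setIntegral_exp_act hω hl hβ hγ hϑ0 hb hc hg hCg hgb μ hE2
    hf.stronglyMeasurable hf2 hexp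
  simp only [← hP] at hF
  rw [hF]
  -- split the Laplace integral of the difference
  set C : ℝ := (∫ z, f z ∂μ) * (∫ z, g z ∂μ) with hC
  have hI := pinnedChain_integrableOn_exp_mul_corr_nice hω hl hβ hγ hN hT hϑ0 h2ϑ hf hg hCf hCg hfb hgb hs.le
  have hIc : IntegrableOn (fun t : ℝ => Real.exp (-(s * t)) * C) (Ioi 0) := hexp.mul_const C
  have hI1 : IntegrableOn (fun t : ℝ => Real.exp (-(s * t)) *
      ∫ z, f z * (∫ y, g y ∂(P.transitionKernel N T T t.toNNReal z)) ∂μ) (Ioi 0) := by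
    refine (hI.add hIc).congr_fun (fun t _ => ?_) measurableSet_Ioi
    simp only [Pi.add_apply, hC]
    ring
  have hsplit : (fun t : ℝ => Real.exp (-(s * t)) *
      ((∫ z, f z * (∫ y, g y ∂(P.transitionKernel N T T t.toNNReal z)) ∂μ) - C)) =
      fun t => Real.exp (-(s * t)) * ∫ z, f z * (∫ y, g y ∂(P.transitionKernel N T T t.toNNReal z)) ∂μ -
        Real.exp (-(s * t)) * C := by
    funext t; ring
  rw [hsplit, integral_sub hI1 hIc, integral_mul_const, integral_exp_neg_mul_Ioi hs]
  ring

/-- **The resolvent of a centred observable**: `R_s (g - m)(z) = R_s g(z) - m/s` (`m` a constant). [folklore] -/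
theorem pinnedChain_resolvent_sub_const {ϑ : ℝ} (hϑ0 : 0 < ϑ) (hϑ1 : ϑ < 1 / T)
    {g : PhaseSpace N → ℝ} (hg : Continuous g) {Cg : ℝ} (hCg : 0 ≤ Cg)
    (hgb : ∀ y, |g y| ≤ Cg * Real.exp (ϑ * (pinnedChain ω₂ lam β γ).hamiltonian N y)) (m : ℝ) {s : ℝ} (hs : 0 < s)
    (z : PhaseSpace N) :
    ∫ t in Ioi (0 : ℝ), Real.exp (-(s * t)) *
        ∫ y, (g y - m) ∂((pinnedChain ω₂ lam β γ).transitionKernel N T T t.toNNReal z) =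
      (∫ t in Ioi (0 : ℝ), Real.exp (-(s * t)) *
        ∫ y, g y ∂((pinnedChain ω₂ lam β γ).transitionKernel N T T t.toNNReal z)) - m / s := by
  haveI : ∀ u, IsMarkovKernel ((pinnedChain ω₂ lam β γ).transitionKernel N T T u) := fun u =>
    pinnedChain_isMarkovKernel_transitionKernel hω hl hβ.le hγ.le N T T u
  have hmb : ∀ y, |(fun _ : PhaseSpace N => m) y| ≤ |m| * Real.exp (ϑ * (pinnedChain ω₂ lam β γ).hamiltonian N y) :=
    fun y => le_mul_of_one_le_right (abs_nonneg _) (pinnedChain_one_le_exp_mul_hamiltonian hω hl hβ hϑ0.le y)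
  rw [pinnedChain_resolvent_sub hω hl hβ hγ hN hT hϑ0 hϑ1 hg continuous_const hCg (abs_nonneg m) hgb hmb hs z]
  congr 1
  have : ∀ t : ℝ, ∫ y, (fun _ : PhaseSpace N => m) y ∂((pinnedChain ω₂ lam β γ).transitionKernel N T T t.toNNReal z) = m :=
    fun t => by simp [integral_const, probReal_univ]
  simp only [this]
  rw [integral_mul_const, integral_exp_neg_mul_Ioi hs]
  ring

/-- **The Laplace-transformed autocorrelation is a centred resolvent pairing**: for a nice `u` with `m = μ_T(u)`,
`ũ = u - m` and `s > 0`: `lap_s(u,u) = ∫ ũ · R_s ũ dμ_T` (the centred observable has the shifted resolvent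
`R_s ũ = R_s u - m/s`, and `∫ R_s u dμ_T = m/s`). [folklore] -/
theorem pinnedChain_lap_self_eq_centred {ϑ : ℝ} (hϑ0 : 0 < ϑ) (h2ϑ : 2 * ϑ < 1 / T)
    {u : PhaseSpace N → ℝ} (hu : Continuous u) {Cu : ℝ} (hCu : 0 ≤ Cu)
    (hub : ∀ y, |u y| ≤ Cu * Real.exp (ϑ * (pinnedChain ω₂ lam β γ).hamiltonian N y)) {s : ℝ} (hs : 0 < s) :
    ∫ t in Ioi (0 : ℝ), Real.exp (-(s * t)) *
        ((∫ z, u z * (∫ y, u y ∂((pinnedChain ω₂ lam β γ).transitionKernel N T T t.toNNReal z))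
            ∂((pinnedChain ω₂ lam β γ).gibbsMeasure N T)) -
          (∫ z, u z ∂((pinnedChain ω₂ lam β γ).gibbsMeasure N T)) *
            (∫ z, u z ∂((pinnedChain ω₂ lam β γ).gibbsMeasure N T))) =
      ∫ z, (u z - ∫ w, u w ∂((pinnedChain ω₂ lam β γ).gibbsMeasure N T)) *
        (∫ t in Ioi (0 : ℝ), Real.exp (-(s * t)) *
          ∫ y, (u y - ∫ w, u w ∂((pinnedChain ω₂ lam β γ).gibbsMeasure N T))
            ∂((pinnedChain ω₂ lam β γ).transitionKernel N T T t.toNNReal z)) ∂((pinnedChain ω₂ lam β γ).gibbsMeasure N T) := by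
  have hϑ1 : ϑ < 1 / T := by linarith
  set P := pinnedChain ω₂ lam β γ with hP
  set μ := P.gibbsMeasure N T with hμ
  haveI : IsProbabilityMeasure μ := pinnedChain_isProbabilityMeasure_gibbsMeasure hω hl hβ.le γ N hT
  set m : ℝ := ∫ w, u w ∂μ with hm
  set R : PhaseSpace N → ℝ := fun z => ∫ t in Ioi (0 : ℝ), Real.exp (-(s * t)) *
    ∫ y, u y ∂(P.transitionKernel N T T t.toNNReal z) with hR
  rw [pinnedChain_lap_eq_integral_mul_resolvent hω hl hβ hγ hN hT hϑ0 h2ϑ hu hu hCu hCu hub hub hs]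
  -- the centred resolvent
  have hRc : ∀ z, ∫ t in Ioi (0 : ℝ), Real.exp (-(s * t)) * ∫ y, (u y - m) ∂(P.transitionKernel N T T t.toNNReal z) =
      R z - m / s := fun z => pinnedChain_resolvent_sub_const hω hl hβ hγ hN hT hϑ0 hϑ1 hu hCu hub m hs z
  simp only [hRc]
  -- integrability
  have hui : Integrable u μ := pinnedChain_integrable_nice hω hl hβ hT hϑ1 hu hub
  have hu2 : Integrable (fun z => u z ^ 2) μ := pinnedChain_integrable_sq_nice hω hl hβ hT h2ϑ hu hub
  obtain ⟨hR2, -⟩ := pinnedChain_integral_sq_resolvent_le hω hl hβ hγ hN hT hϑ0 h2ϑ hu hCu hub hs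
  have hRm : AEStronglyMeasurable R μ :=
    (pinnedChain_stronglyMeasurable_resolvent hω hl hβ.le hγ.le T T hu.measurable s).aestronglyMeasurable
  have hRi : Integrable R μ := by
    have hI : Integrable (fun z => (1 + R z ^ 2) / 2) μ := ((integrable_const (1 : ℝ)).add hR2).div_const 2
    refine hI.mono' hRm (Eventually.of_forall fun z => ?_)
    rw [Real.norm_eq_abs]
    nlinarith [sq_nonneg (|R z| - 1), sq_abs (R z), abs_nonneg (R z)]
  have huR : Integrable (fun z => u z * R z) μ := integrable_mul_of_sq hu.aestronglyMeasurable hRm hu2 hR2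
  have hRint : ∫ z, R z ∂μ = m / s := pinnedChain_integral_resolvent_eq hω hl hβ hγ hN hT hϑ0 h2ϑ hu hCu hub hs
  -- expand
  have e1 : (fun z => (u z - m) * (R z - m / s)) = fun z => u z * R z - (m / s) * u z - m * R z + m * (m / s) := by
    funext z; ring
  rw [e1, integral_add, integral_sub, integral_sub huR (hui.const_mul _), integral_const_mul, integral_const_mul,
    integral_const, hRint]
  · simp only [probReal_univ, smul_eq_mul, one_mul]
    rw [← hm]
    field_simp
    ring
  · exact huR.sub (hui.const_mul _)
  · exact hRi.const_mul _
  · exact (huR.sub (hui.const_mul _)).sub (hRi.const_mul _)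
  · exact integrable_const _

/-! ### Positivity of the Laplace-transformed autocorrelation -/

/-- **`lap_s(u,u) > 0`** for every `s > 0` and every nice observable `u` with positive variance
`∫ (u - μ_T u)² dμ_T > 0`: `lap_s(u,u) = ⟨ũ, R_s ũ⟩ ≥ s‖R_s ũ‖²` (`pinnedChain_integral_mul_resolvent_ge`), and equality
`‖R_s ũ‖ = 0` would force `‖ũ‖ = 0` (`pinnedChain_integral_sq_eq_zero_of_resolvent`). [folklore] -/
theorem pinnedChain_lap_self_pos {ϑ : ℝ} (hϑ0 : 0 < ϑ) (h2ϑ : 2 * ϑ < 1 / T)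
    {u : PhaseSpace N → ℝ} (hu : Continuous u) {Cu : ℝ} (hCu : 0 ≤ Cu)
    (hub : ∀ y, |u y| ≤ Cu * Real.exp (ϑ * (pinnedChain ω₂ lam β γ).hamiltonian N y)) {s : ℝ} (hs : 0 < s)
    (hvar : 0 < ∫ z, (u z - ∫ w, u w ∂((pinnedChain ω₂ lam β γ).gibbsMeasure N T)) ^ 2
      ∂((pinnedChain ω₂ lam β γ).gibbsMeasure N T)) :
    0 < ∫ t in Ioi (0 : ℝ), Real.exp (-(s * t)) *
        ((∫ z, u z * (∫ y, u y ∂((pinnedChain ω₂ lam β γ).transitionKernel N T T t.toNNReal z))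
            ∂((pinnedChain ω₂ lam β γ).gibbsMeasure N T)) -
          (∫ z, u z ∂((pinnedChain ω₂ lam β γ).gibbsMeasure N T)) *
            (∫ z, u z ∂((pinnedChain ω₂ lam β γ).gibbsMeasure N T))) := by
  set P := pinnedChain ω₂ lam β γ with hP
  set μ := P.gibbsMeasure N T with hμ
  set m : ℝ := ∫ w, u w ∂μ with hm
  rw [pinnedChain_lap_self_eq_centred hω hl hβ hγ hN hT hϑ0 h2ϑ hu hCu hub hs]
  -- the centred observable is nice
  have hvc : Continuous fun z => u z - m := hu.sub continuous_const
  have hvb : ∀ y, |u y - m| ≤ (Cu + |m|) * Real.exp (ϑ * P.hamiltonian N y) := fun y => by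
    have h1 := hub y
    have h2 : |m| ≤ |m| * Real.exp (ϑ * P.hamiltonian N y) :=
      le_mul_of_one_le_right (abs_nonneg _) (pinnedChain_one_le_exp_mul_hamiltonian hω hl hβ hϑ0.le y)
    calc |u y - m| ≤ |u y| + |m| := abs_sub _ _
      _ ≤ Cu * Real.exp (ϑ * P.hamiltonian N y) + |m| * Real.exp (ϑ * P.hamiltonian N y) := add_le_add h1 h2
      _ = (Cu + |m|) * Real.exp (ϑ * P.hamiltonian N y) := by ring
  have hC0 : 0 ≤ Cu + |m| := by positivity
  have hge := pinnedChain_integral_mul_resolvent_ge hω hl hβ hγ hN hT hϑ0 h2ϑ hvc hC0 hvb hs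
  have hsq0 : 0 ≤ ∫ z, (∫ t in Ioi (0 : ℝ), Real.exp (-(s * t)) *
      ∫ y, (u y - m) ∂(P.transitionKernel N T T t.toNNReal z)) ^ 2 ∂μ := integral_nonneg fun z => sq_nonneg _
  by_contra hneg
  push Not at hneg
  have hzero : ∫ z, (∫ t in Ioi (0 : ℝ), Real.exp (-(s * t)) *
      ∫ y, (u y - m) ∂(P.transitionKernel N T T t.toNNReal z)) ^ 2 ∂μ = 0 := by
    refine le_antisymm ?_ hsq0
    by_contra hpos
    push Not at hpos
    have : 0 < s * ∫ z, (∫ t in Ioi (0 : ℝ), Real.exp (-(s * t)) *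
        ∫ y, (u y - m) ∂(P.transitionKernel N T T t.toNNReal z)) ^ 2 ∂μ := mul_pos hs hpos
    linarith
  have h0 := pinnedChain_integral_sq_eq_zero_of_resolvent hω hl hβ hγ hN hT hϑ0 h2ϑ hvc hC0 hvb hs hzero
  simp only [hm] at h0
  linarith

end PinnedL

section PinnedBL

variable {ω₂ lam β γ : ℝ} (hω : 0 < ω₂) (hl : 0 ≤ lam) (hβ : 0 < β) (hγ : 0 < γ) (hN : 0 < N)
  {T : ℝ} (hT : 0 < T)
include hω hl hβ hγ hN hT

/-! ### Bilinearity of the Laplace-transformed correlation -/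

omit hβ hγ in
/-- `P_t (∑ ξ_x e_x) = ∑ ξ_x P_t e_x` pointwise, for nice `e_x`. [folklore] -/
theorem pinnedChain_act_sum (hβ' : 0 ≤ β) (hγ' : 0 ≤ γ) {ϑ : ℝ} (hϑ0 : 0 < ϑ) (hϑ1 : ϑ < 1 / T)
    {e : Fin N → PhaseSpace N → ℝ} (he : ∀ x, Continuous (e x)) {C : ℝ}
    (heb : ∀ x y, |e x y| ≤ C * Real.exp (ϑ * (pinnedChain ω₂ lam β γ).hamiltonian N y)) (ξ : Fin N → ℝ)
    (t : ℝ≥0) (z : PhaseSpace N) :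
    ∫ y, (∑ x, ξ x * e x y) ∂((pinnedChain ω₂ lam β γ).transitionKernel N T T t z) =
      ∑ x, ξ x * ∫ y, e x y ∂((pinnedChain ω₂ lam β γ).transitionKernel N T T t z) := by
  have hi : ∀ x, Integrable (e x) ((pinnedChain ω₂ lam β γ).transitionKernel N T T t z) := fun x =>
    pinnedChain_integrable_transitionKernel_of_abs_le hω hl hN hT hβ' hγ' hϑ0 hϑ1 (he x) (heb x) t z
  rw [integral_finsetSum _ fun x _ => (hi x).const_mul _]
  exact Finset.sum_congr rfl fun x _ => integral_const_mul _ _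

/-- **Bilinearity**: `corr(u,u)(t) = ∑_x ∑_y ξ_x ξ_y corr(e_x,e_y)(t)` for `u = ∑ ξ_x e_x` (nice `e_x`, `0 < ϑ`, `2ϑ < 1/T`).
[folklore] -/
theorem pinnedChain_corr_sum_sum {ϑ : ℝ} (hϑ0 : 0 < ϑ) (h2ϑ : 2 * ϑ < 1 / T)
    {e : Fin N → PhaseSpace N → ℝ} (he : ∀ x, Continuous (e x)) {C : ℝ}
    (heb : ∀ x y, |e x y| ≤ C * Real.exp (ϑ * (pinnedChain ω₂ lam β γ).hamiltonian N y)) (ξ : Fin N → ℝ) (t : ℝ) :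
    (∫ z, (∑ x, ξ x * e x z) * (∫ y, (∑ x, ξ x * e x y) ∂((pinnedChain ω₂ lam β γ).transitionKernel N T T t.toNNReal z))
        ∂((pinnedChain ω₂ lam β γ).gibbsMeasure N T)) -
      (∫ z, (∑ x, ξ x * e x z) ∂((pinnedChain ω₂ lam β γ).gibbsMeasure N T)) *
        (∫ z, (∑ x, ξ x * e x z) ∂((pinnedChain ω₂ lam β γ).gibbsMeasure N T)) =
    ∑ x, ∑ y, ξ x * ξ y *
      ((∫ z, e x z * (∫ w, e y w ∂((pinnedChain ω₂ lam β γ).transitionKernel N T T t.toNNReal z))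
          ∂((pinnedChain ω₂ lam β γ).gibbsMeasure N T)) -
        (∫ z, e x z ∂((pinnedChain ω₂ lam β γ).gibbsMeasure N T)) *
          (∫ z, e y z ∂((pinnedChain ω₂ lam β γ).gibbsMeasure N T))) := by
  have hϑ1 : ϑ < 1 / T := by linarith
  set P := pinnedChain ω₂ lam β γ with hP
  set μ := P.gibbsMeasure N T with hμ
  set κ := P.transitionKernel N T T t.toNNReal with hκ
  have hei : ∀ x, Integrable (e x) μ := fun x => pinnedChain_integrable_nice hω hl hβ hT hϑ1 (he x) (heb x)
  have heij : ∀ x y, Integrable (fun z => e x z * ∫ w, e y w ∂(κ z)) μ := fun x y =>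
    pinnedChain_integrable_mul_act_nice hω hl hβ hγ hN hT hϑ0 h2ϑ (he x) (he y) (heb x) (heb y) _
  -- `P_t u = ∑ ξ_y P_t e_y`
  have hact : ∀ z, ∫ y, (∑ x, ξ x * e x y) ∂(κ z) = ∑ x, ξ x * ∫ y, e x y ∂(κ z) := fun z =>
    pinnedChain_act_sum hω hl hN hT hβ.le hγ.le hϑ0 hϑ1 he heb ξ _ z
  simp only [hact]
  -- expand the product of sums
  have hprod : (fun z => (∑ x, ξ x * e x z) * ∑ x, ξ x * ∫ y, e x y ∂(κ z)) =
      fun z => ∑ x, ∑ y, (ξ x * ξ y) * (e x z * ∫ w, e y w ∂(κ z)) := by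
    funext z
    rw [Finset.sum_mul_sum]
    refine Finset.sum_congr rfl fun x _ => Finset.sum_congr rfl fun y _ => by ring
  rw [hprod, integral_finsetSum _ fun x _ => integrable_finsetSum _ fun y _ => (heij x y).const_mul _]
  have h1 : ∀ x, ∫ z, ∑ y, ξ x * ξ y * (e x z * ∫ w, e y w ∂(κ z)) ∂μ =
      ∑ y, ξ x * ξ y * ∫ z, e x z * ∫ w, e y w ∂(κ z) ∂μ := fun x => by
    rw [integral_finsetSum _ fun y _ => (heij x y).const_mul _]
    exact Finset.sum_congr rfl fun y _ => integral_const_mul _ _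
  simp only [h1]
  -- the mean
  have hmean : ∫ z, (∑ x, ξ x * e x z) ∂μ = ∑ x, ξ x * ∫ z, e x z ∂μ := by
    rw [integral_finsetSum _ fun x _ => (hei x).const_mul _]
    exact Finset.sum_congr rfl fun x _ => integral_const_mul _ _
  rw [hmean, Finset.sum_mul_sum, ← Finset.sum_sub_distrib]
  refine Finset.sum_congr rfl fun x _ => ?_
  rw [← Finset.sum_sub_distrib]
  exact Finset.sum_congr rfl fun y _ => by ring

/-- **`ξᵀ G(s) ξ = lap_s(u, u)`**: the quadratic form of the matrix of Laplace-transformed correlations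
`G(s)_{xy} = ∫_{(0,∞)} e^{-st} corr(e_x,e_y)(t) dt` of nice observables is the Laplace-transformed autocorrelation of
`u = ∑ ξ_x e_x` (`s ≥ 0`). [folklore] -/
theorem pinnedChain_sum_lap_eq_lap_sum {ϑ : ℝ} (hϑ0 : 0 < ϑ) (h2ϑ : 2 * ϑ < 1 / T)
    {e : Fin N → PhaseSpace N → ℝ} (he : ∀ x, Continuous (e x)) {C : ℝ} (hC : 0 ≤ C)
    (heb : ∀ x y, |e x y| ≤ C * Real.exp (ϑ * (pinnedChain ω₂ lam β γ).hamiltonian N y)) (ξ : Fin N → ℝ)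
    {s : ℝ} (hs : 0 ≤ s) :
    ∑ x, ∑ y, ξ x * (∫ t in Ioi (0 : ℝ), Real.exp (-(s * t)) *
      ((∫ z, e x z * (∫ w, e y w ∂((pinnedChain ω₂ lam β γ).transitionKernel N T T t.toNNReal z))
          ∂((pinnedChain ω₂ lam β γ).gibbsMeasure N T)) -
        (∫ z, e x z ∂((pinnedChain ω₂ lam β γ).gibbsMeasure N T)) *
          (∫ z, e y z ∂((pinnedChain ω₂ lam β γ).gibbsMeasure N T)))) * ξ y =
    ∫ t in Ioi (0 : ℝ), Real.exp (-(s * t)) *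
      ((∫ z, (∑ x, ξ x * e x z) * (∫ y, (∑ x, ξ x * e x y) ∂((pinnedChain ω₂ lam β γ).transitionKernel N T T t.toNNReal z))
          ∂((pinnedChain ω₂ lam β γ).gibbsMeasure N T)) -
        (∫ z, (∑ x, ξ x * e x z) ∂((pinnedChain ω₂ lam β γ).gibbsMeasure N T)) *
          (∫ z, (∑ x, ξ x * e x z) ∂((pinnedChain ω₂ lam β γ).gibbsMeasure N T))) := by
  set P := pinnedChain ω₂ lam β γ with hP
  set μ := P.gibbsMeasure N T with hμ
  set corr : Fin N → Fin N → ℝ → ℝ := fun x y t =>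
    (∫ z, e x z * (∫ w, e y w ∂(P.transitionKernel N T T t.toNNReal z)) ∂μ) -
      (∫ z, e x z ∂μ) * (∫ z, e y z ∂μ) with hcorr
  have hI : ∀ x y, IntegrableOn (fun t : ℝ => Real.exp (-(s * t)) * corr x y t) (Ioi 0) := fun x y =>
    pinnedChain_integrableOn_exp_mul_corr_nice hω hl hβ hγ hN hT hϑ0 h2ϑ (he x) (he y) hC hC (heb x) (heb y) hs
  have hrhs : ∀ t : ℝ, Real.exp (-(s * t)) *
      ((∫ z, (∑ x, ξ x * e x z) * (∫ y, (∑ x, ξ x * e x y) ∂(P.transitionKernel N T T t.toNNReal z)) ∂μ) -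
        (∫ z, (∑ x, ξ x * e x z) ∂μ) * (∫ z, (∑ x, ξ x * e x z) ∂μ)) =
      ∑ x, ∑ y, ξ x * ξ y * (Real.exp (-(s * t)) * corr x y t) := by
    intro t
    rw [pinnedChain_corr_sum_sum hω hl hβ hγ hN hT hϑ0 h2ϑ he heb ξ t, Finset.mul_sum]
    refine Finset.sum_congr rfl fun x _ => ?_
    rw [Finset.mul_sum]
    exact Finset.sum_congr rfl fun y _ => by ring
  have hrhs' : (fun t : ℝ => Real.exp (-(s * t)) *
      ((∫ z, (∑ x, ξ x * e x z) * (∫ y, (∑ x, ξ x * e x y) ∂(P.transitionKernel N T T t.toNNReal z)) ∂μ) -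
        (∫ z, (∑ x, ξ x * e x z) ∂μ) * (∫ z, (∑ x, ξ x * e x z) ∂μ))) =
      fun t => ∑ x, ∑ y, ξ x * ξ y * (Real.exp (-(s * t)) * corr x y t) := funext hrhs
  rw [hrhs', integral_finsetSum _ fun x _ => integrable_finsetSum _ fun y _ => (hI x y).const_mul _]
  refine Finset.sum_congr rfl fun x _ => ?_
  rw [integral_finsetSum _ fun y _ => (hI x y).const_mul _]
  refine Finset.sum_congr rfl fun y _ => ?_
  rw [integral_const_mul]
  ring

/-! ### Positive definiteness of `G(s)` -/

/-- **Positive definiteness of the Laplace-transformed correlation matrix** (clause (iv-b) of `FeshbachIdentities`,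
generic form): for nice `e_x` (`0 < ϑ`, `2ϑ < 1/T`), `s > 0`, and `ξ` such that `u = ∑ ξ_x e_x` takes two different
values, `ξᵀ G(s) ξ = lap_s(u,u) > 0`. [folklore] -/
theorem pinnedChain_sum_lap_pos {ϑ : ℝ} (hϑ0 : 0 < ϑ) (h2ϑ : 2 * ϑ < 1 / T)
    {e : Fin N → PhaseSpace N → ℝ} (he : ∀ x, Continuous (e x)) {C : ℝ} (hC : 0 ≤ C)
    (heb : ∀ x y, |e x y| ≤ C * Real.exp (ϑ * (pinnedChain ω₂ lam β γ).hamiltonian N y)) (ξ : Fin N → ℝ)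
    {z₀ z₁ : PhaseSpace N} (hne : ∑ x, ξ x * e x z₀ ≠ ∑ x, ξ x * e x z₁) {s : ℝ} (hs : 0 < s) :
    0 < ∑ x, ∑ y, ξ x * (∫ t in Ioi (0 : ℝ), Real.exp (-(s * t)) *
      ((∫ z, e x z * (∫ w, e y w ∂((pinnedChain ω₂ lam β γ).transitionKernel N T T t.toNNReal z))
          ∂((pinnedChain ω₂ lam β γ).gibbsMeasure N T)) -
        (∫ z, e x z ∂((pinnedChain ω₂ lam β γ).gibbsMeasure N T)) *
          (∫ z, e y z ∂((pinnedChain ω₂ lam β γ).gibbsMeasure N T)))) * ξ y := by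
  rw [pinnedChain_sum_lap_eq_lap_sum hω hl hβ hγ hN hT hϑ0 h2ϑ he hC heb ξ hs.le]
  have huc : Continuous fun z => ∑ x, ξ x * e x z := continuous_finsetSum _ fun x _ => continuous_const.mul (he x)
  have hub : ∀ y, |∑ x, ξ x * e x y| ≤ (∑ x, |ξ x| * C) * Real.exp (ϑ * (pinnedChain ω₂ lam β γ).hamiltonian N y) :=
    fun y => abs_sum_mul_le_exp_bound Finset.univ heb ξ y
  have hK0 : 0 ≤ ∑ x, |ξ x| * C := Finset.sum_nonneg fun x _ => mul_nonneg (abs_nonneg _) hC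
  have hvar : 0 < ∫ z, ((∑ x, ξ x * e x z) - ∫ w, (∑ x, ξ x * e x w) ∂((pinnedChain ω₂ lam β γ).gibbsMeasure N T)) ^ 2
      ∂((pinnedChain ω₂ lam β γ).gibbsMeasure N T) := by
    rw [← pinnedChain_sum_cov_eq_integral_sq_sub hω hl hβ.le hT h2ϑ he hC heb ξ]
    exact pinnedChain_sum_cov_pos hω hl hβ.le hT hϑ0 h2ϑ he hC heb ξ hne
  exact pinnedChain_lap_self_pos hω hl hβ hγ hN hT hϑ0 h2ϑ huc hK0 hub hs hvar

end PinnedBL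

end Summit.AtomisticToContinuum.FouriersLaw.Theorems.HonestZwanzig

end
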